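import Literature.IUT.HodgeArakelov.ModelReconstruction
import Mathlib.GroupTheory.OrderOfElement

/-!
# [IUTchII] Def. 1.1 (ii) at the [EtTh] model: the rigidity isomorphism of `ModelReconstruction` depends on
# the identification `Π_M ≅ Π^tp_Y[μ_N]` — kernel witness (proof-only; finding F-w5d145-1 of AUDIT-p410630)

abc-iut cell (abc-iut-w5-d145; audit of bridge B8 part 5b `ModelReconstruction.lean`, abc-iut-L6-d6). S. Mochizuki,
*Inter-universal Teichmüller theory II*, §1 Def. 1.1 (ii), kurims p. 21: "there is a functorial algorithm for
constructing from `M` a cyclotomic rigidity isomorphism `(l·Δ_Θ)(M) ⊗ (ℤ/Nℤ) ⥲ Π_μ(M)`" [cf. [EtTh] Cor. 2.19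
(i): "the natural isomorphism of cyclotomes determined by `s^alg`, `s^Θ`"] [claim: Mochizuki2012, status: disputed]
(IUTchII §1 Def 1.1 (ii), kurims p.21); [cite: MochizukiEtTh2009, Cor 2.19(i) p.64].

`ModelFrame.cyclotomicRigidity F e` (B8 part 5b) builds the Def. 1.1 (ii) isomorphism of a mono-theta environment
`M` from a BARE identification of topological groups `e : Π_M ≃ₜ* Π^tp_Y[μ_N]` with the model envelope. This file
records, sorry-free and definition-free:

* `ModelCyclotomes.exists_powTwist`: for every `n` coprime to `N` there is a continuous automorphism `τ` of
  `Π^tp_Y[μ_N] = μ_N ⋊ Π^tp_Y` over `Π^tp_Y` (`proj ∘ τ = proj`) acting on the cyclotome by `a ↦ a^n` — it exists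
  because the power map commutes with the cyclotomic character action;
* `ModelFrame.cyclotomicRigidity_twist_apply`: replacing `e` by `e ≫ τ⁻¹` leaves the reconstructed exterior
  cyclotome `Π_μ(M) ⊆ Π_M` (as a subgroup) unchanged but multiplies the rigidity isomorphism by `n`:
  its underlying map becomes `c ↦ e⁻¹(inMu((intModEquiv c)^n))`;
* `ModelFrame.cyclotomicRigidity_not_determined`: hence for `N ≥ 3` the SAME mono-theta environment `M` (same frame)
  carries two Def. 1.1 outputs with the same `Π_μ(M)` whose rigidity isomorphisms DIFFER as maps into `Π_M`.

READING (neutral): this is the kernel form of "cyclotomic rigidity is a property of the mono-theta STRUCTURE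
(`D`, `s^Θ`), not of the underlying topological group": THE [EtTh] isomorphism of `M` is `cyclotomicRigidity F e`
for `e` underlying an isomorphism of mono-theta environments with the model (bridge B8 parts 1–3), and its
independence of that choice is [EtTh] Cor. 2.19 (i) (L2 `RigidData.Cor219_i_splittings`). The existence
theorems of part 5b/6 are unaffected. Nothing disputed is asserted; no side is taken on [IUTchIII] Cor. 3.12;
typed ≠ discharged.
-/

namespace Literature.IUT.HodgeArakelov

universe u

open Literature.AnabelianGeometry.EtaleTheta
open scoped Literature.AnabelianGeometry.EtaleTheta

namespace ModelCyclotomes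

variable {N : ℕ+} {l : ℕ} (R : RigidData.{u} N l)

/-- **The `n`-th power twist of the model envelope** (`n` coprime to `N`): a continuous group automorphism `τ`
of `Π^tp_Y[μ_N] = μ_N ⋊ Π^tp_Y` with `proj ∘ τ = proj` and `τ(inMu a) = inMu (a^n)` — in fact
`τ(a, y) = (a^n, y)`; it is multiplicative because `a ↦ a^n` commutes with the character action `χ(aug y)`.
PROVED (existence; no definition is introduced). [cite: MochizukiEtTh2009, Def 2.13(ii) p.47] -/
theorem exists_powTwist (n : ℕ) (hn : (N : ℕ).Coprime n) :
    ∃ τ : R.env ≃ₜ* R.env,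
      (∀ x, CycEnvelope.proj R.augY R.chi (τ x) = CycEnvelope.proj R.augY R.chi x) ∧
      (∀ x, (τ x).left = x.left ^ n) ∧
      ∀ a, τ (CycEnvelope.inMu R.augY R.chi a) = CycEnvelope.inMu R.augY R.chi (a ^ n) := by
  have hcard : (Nat.card R.mu).Coprime n := by rwa [natCard_mu R]
  let p : R.mu ≃ R.mu := powCoprime hcard
  have hp : ∀ a, p a = a ^ n := fun a => rfl
  let τ : R.env ≃ₜ* R.env :=
    { toFun := fun x => ⟨p x.left, x.right⟩
      invFun := fun x => ⟨p.symm x.left, x.right⟩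
      left_inv := fun x => by ext <;> simp
      right_inv := fun x => by ext <;> simp
      map_mul' := fun x y => by
        ext
        · simp only [SemidirectProduct.mul_left, hp, mul_pow, MonoidHom.coe_comp, Function.comp_apply,
            map_pow]
        · rfl
      continuous_toFun :=
        R.continuous_env_mk (continuous_of_discreteTopology.comp R.continuous_left) R.continuous_right
      continuous_invFun :=
        R.continuous_env_mk (continuous_of_discreteTopology.comp R.continuous_left) R.continuous_right }
  refine ⟨τ, fun x => rfl, fun x => rfl, fun a => ?_⟩
  ext
  · rfl
  · rfl

end ModelCyclotomes

namespace ModelFrame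

open ModelCyclotomes

variable {S : ThetaSetting.{u}} {l : ℕ} {R : RigidData.{u} S.N l} (F : ModelFrame S R) {M : MonoThetaEnv S}
  (e : M.Pi ≃ₜ* R.env)

/-- The rigidity isomorphism of B8 part 5b on elements: `c ↦ e⁻¹(inMu(intModEquiv c))` (definitional).
[claim: Mochizuki2012, status: disputed] (IUTchII §1 Def 1.1 (ii), kurims p.21) -/
theorem cyclotomicRigidity_apply (c : ModPow (intCyc R).carrier (S.N : ℕ)) :
    (((F.cyclotomicRigidity e).iso c : (F.reconstruction e).extCyc) : M.Pi) =
      e.symm (CycEnvelope.inMu R.augY R.chi (intModEquiv R c)) := rfl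

/-- **Twisting the identification multiplies the rigidity isomorphism.** For an automorphism `τ` of the model
envelope over `Π^tp_Y` acting by `a ↦ a^n` on `μ_N` (`exists_powTwist`), the Def. 1.1 (ii) isomorphism built from
`e ≫ τ⁻¹` is `c ↦ e⁻¹(inMu((intModEquiv c)^n))`, while the exterior cyclotome `Π_μ(M) ⊆ Π_M` is the same subgroup.
PROVED. [claim: Mochizuki2012, status: disputed] (IUTchII §1 Def 1.1 (ii), kurims p.21) -/
theorem cyclotomicRigidity_twist_apply {n : ℕ} (τ : R.env ≃ₜ* R.env)
    (hproj : ∀ x, CycEnvelope.proj R.augY R.chi (τ x) = CycEnvelope.proj R.augY R.chi x)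
    (hinMu : ∀ a, τ (CycEnvelope.inMu R.augY R.chi a) = CycEnvelope.inMu R.augY R.chi (a ^ n))
    (c : ModPow (intCyc R).carrier (S.N : ℕ)) :
    (F.reconstruction (e.trans τ.symm)).extCyc = (F.reconstruction e).extCyc ∧
    (((F.cyclotomicRigidity (e.trans τ.symm)).iso c : (F.reconstruction (e.trans τ.symm)).extCyc) : M.Pi) =
      e.symm (CycEnvelope.inMu R.augY R.chi ((intModEquiv R c) ^ n)) := by
  constructor
  · ext m
    change CycEnvelope.proj R.augY R.chi (τ.symm (e m)) = 1 ↔ CycEnvelope.proj R.augY R.chi (e m) = 1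
    rw [← hproj (τ.symm (e m)), ContinuousMulEquiv.apply_symm_apply]
  · change (e.trans τ.symm).symm (CycEnvelope.inMu R.augY R.chi (intModEquiv R c)) = _
    change e.symm (τ.symm.symm (CycEnvelope.inMu R.augY R.chi (intModEquiv R c))) = _
    rw [ContinuousMulEquiv.symm_symm, hinMu]

/-- **The Def. 1.1 (ii) output of B8 part 5b is NOT determined by the bare topological identification**
(`N ≥ 3`): for every frame `F` and identification `e` there is a second identification `e'` of the SAME
mono-theta environment with the SAME model giving the same exterior cyclotome `Π_μ(M) ⊆ Π_M` (and, by
construction, the same `Π_X(M)`, `(l·Δ_Θ)(M)`, actions) but a DIFFERENT rigidity isomorphism — the inverse twist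
`a ↦ a^{N-1} = a⁻¹`, which moves any `a` with `a² ≠ 1`. Hence THE [EtTh] Cor. 2.19 (i) isomorphism is singled out
only by identifications respecting the mono-theta structure (finding F-w5d145-1; the pinning lemma is [EtTh]
Cor. 2.19 (i), L2 `RigidData.Cor219_i_splittings`). PROVED.
[claim: Mochizuki2012, status: disputed] (IUTchII §1 Def 1.1 (ii), kurims p.21) -/
theorem cyclotomicRigidity_not_determined (hN : 3 ≤ (S.N : ℕ)) :
    ∃ e' : M.Pi ≃ₜ* R.env,
      (F.reconstruction e').extCyc = (F.reconstruction e).extCyc ∧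
      ∃ c : ModPow (intCyc R).carrier (S.N : ℕ),
        (((F.cyclotomicRigidity e').iso c : (F.reconstruction e').extCyc) : M.Pi) ≠
          (((F.cyclotomicRigidity e).iso c : (F.reconstruction e).extCyc) : M.Pi) := by
  -- the inverse twist: `n = N - 1` is coprime to `N`
  have hn : ((S.N : ℕ)).Coprime ((S.N : ℕ) - 1) := by
    have h1 : 0 < (S.N : ℕ) := S.N.pos
    rw [Nat.Coprime, Nat.gcd_comm, ← Nat.Coprime]
    have : (S.N : ℕ) = (S.N : ℕ) - 1 + 1 := by omega
    conv_rhs => rw [this]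
    exact Nat.coprime_self_add_right.mpr (Nat.coprime_one_right _)
  obtain ⟨τ, hproj, -, hinMu⟩ := exists_powTwist R ((S.N : ℕ) - 1) hn
  refine ⟨e.trans τ.symm, (F.cyclotomicRigidity_twist_apply e τ hproj hinMu (1 : _)).1, ?_⟩
  -- a generator `a` of `μ_N` and a preimage `c` under the bijection `intModEquiv`
  haveI := R.mu_cyclic
  obtain ⟨a, ha⟩ := IsCyclic.exists_ofOrder_eq_natCard (α := R.mu)
  obtain ⟨c, hc⟩ := (intModEquiv R).surjective a
  refine ⟨c, ?_⟩
  rw [(F.cyclotomicRigidity_twist_apply e τ hproj hinMu c).2, F.cyclotomicRigidity_apply e c, hc]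
  intro h
  have h2 : a ^ ((S.N : ℕ) - 1) = a :=
    SemidirectProduct.inl_injective (e.symm.injective h)
  -- then `a^(N-2) = 1`, contradicting `orderOf a = N ≥ 3`
  have hN' : (S.N : ℕ) - 1 = ((S.N : ℕ) - 2) + 1 := by omega
  rw [hN', pow_succ, mul_eq_right] at h2
  have hdvd := orderOf_dvd_of_pow_eq_one h2
  rw [ha, natCard_mu R] at hdvd
  have : (S.N : ℕ) ≤ (S.N : ℕ) - 2 := Nat.le_of_dvd (by omega) hdvd
  omega

end ModelFrame

namespace ModelFrame

open ModelCyclotomes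

variable {S : ThetaSetting.{u}} {l : ℕ} {R : RigidData.{u} S.N l} (F : ModelFrame S R) {M : MonoThetaEnv S}
  (e : M.Pi ≃ₜ* R.env)

/-! ## v2 (append-only): the twisted identification changes NOTHING ELSE in the Def. 1.1 output
(audit INFO of abc-iut-w5-d089 on p414640: make "same data except the isomorphism" kernel-explicit) -/

/-- Twisting the identification leaves `Π_X(M)` unchanged (definitionally `Π^tp_X`).
[claim: Mochizuki2012, status: disputed] (IUTchII §1 Def 1.1 (i), kurims p.21) -/
theorem reconstruction_twist_PiX (τ : R.env ≃ₜ* R.env) :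
    (F.reconstruction (e.trans τ.symm)).PiX = (F.reconstruction e).PiX := rfl

/-- … leaves `Π_Y(M)` unchanged (definitionally `Π^tp_Y`). [claim: Mochizuki2012, status: disputed] (IUTchII §1 Def 1.1 (i), kurims p.21) -/
theorem reconstruction_twist_PiY (τ : R.env ≃ₜ* R.env) :
    (F.reconstruction (e.trans τ.symm)).PiY = (F.reconstruction e).PiY := rfl

/-- … leaves the interior cyclotome `(l·Δ_Θ)(M)` unchanged (definitionally).
[claim: Mochizuki2012, status: disputed] (IUTchII §1 Def 1.1 (i), kurims p.21) -/
theorem reconstruction_twist_intCyc (τ : R.env ≃ₜ* R.env) :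
    (F.reconstruction (e.trans τ.symm)).intCyc = (F.reconstruction e).intCyc := rfl

/-- … leaves the `Π_X(M)`-action on `(l·Δ_Θ)(M)` unchanged (definitionally).
[claim: Mochizuki2012, status: disputed] (IUTchII §1 Def 1.1 (i), kurims p.21) -/
theorem reconstruction_twist_intAct (τ : R.env ≃ₜ* R.env) :
    (F.reconstruction (e.trans τ.symm)).intAct = (F.reconstruction e).intAct := rfl

/-- … leaves `G(M)`, `Π_X(M) ↠ G(M)` and `Π_Y(M) ⊆ Π_X(M)` unchanged (definitionally).
[claim: Mochizuki2012, status: disputed] (IUTchII §1 Def 1.1 (i), kurims p.21) -/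
theorem reconstruction_twist_projG (τ : R.env ≃ₜ* R.env) :
    (F.reconstruction (e.trans τ.symm)).projG = (F.reconstruction e).projG ∧
      (F.reconstruction (e.trans τ.symm)).inclY = (F.reconstruction e).inclY := ⟨rfl, rfl⟩

/-- … and leaves the quotient MAP `Π_M ↠ Π_Y(M)` unchanged, for `τ` over `Π^tp_Y` (PROVED).
[claim: Mochizuki2012, status: disputed] (IUTchII §1 Def 1.1 (i), kurims p.21) -/
theorem reconstruction_twist_projY_apply (τ : R.env ≃ₜ* R.env)
    (hproj : ∀ x, CycEnvelope.proj R.augY R.chi (τ x) = CycEnvelope.proj R.augY R.chi x) (m : M.Pi) :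
    (F.reconstruction (e.trans τ.symm)).projY m = (F.reconstruction e).projY m := by
  change CycEnvelope.proj R.augY R.chi (τ.symm (e m)) = CycEnvelope.proj R.augY R.chi (e m)
  rw [← hproj (τ.symm (e m)), ContinuousMulEquiv.apply_symm_apply]

/-- … and leaves the `Π_X(M)`-ACTION on the exterior cyclotome `Π_μ(M) ⊆ Π_M` unchanged on underlying
elements, for `τ` over `Π^tp_Y` acting on `μ_N` by an `n`-th power (the character action commutes with
powers) (PROVED). Together with `cyclotomicRigidity_twist_apply`: the two Def. 1.1 outputs agree in EVERY
datum except the rigidity isomorphism. [claim: Mochizuki2012, status: disputed] (IUTchII §1 Def 1.1 (i), kurims p.21) -/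
theorem reconstruction_twist_extAct_apply {n : ℕ} (τ : R.env ≃ₜ* R.env)
    (hinMu : ∀ a, τ (CycEnvelope.inMu R.augY R.chi a) = CycEnvelope.inMu R.augY R.chi (a ^ n))
    (x : R.PiX) (a : R.mu) :
    (((F.reconstruction (e.trans τ.symm)).extAct x (extEquiv (e.trans τ.symm) a) :
        (F.reconstruction (e.trans τ.symm)).extCyc) : M.Pi) =
      (((F.reconstruction e).extAct x (extEquiv e (a ^ n)) : (F.reconstruction e).extCyc) : M.Pi) := by
  rw [reconstruction_extAct_apply, reconstruction_extAct_apply, MulEquiv.symm_apply_apply,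
    MulEquiv.symm_apply_apply, coe_extEquiv, coe_extEquiv, map_pow]
  change e.symm (τ.symm.symm (CycEnvelope.inMu R.augY R.chi (R.chi (R.aug x) a))) = _
  rw [ContinuousMulEquiv.symm_symm, hinMu, map_pow]

/-- The exterior cyclotome identifications are related by the `n`-th power: `extEquiv (e ≫ τ⁻¹) a` and
`extEquiv e (a^n)` have the same underlying element of `Π_M` (PROVED).
[claim: Mochizuki2012, status: disputed] (IUTchII §1 Def 1.1 (i), kurims p.21) -/
theorem extEquiv_twist_apply {n : ℕ} (τ : R.env ≃ₜ* R.env)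
    (hinMu : ∀ a, τ (CycEnvelope.inMu R.augY R.chi a) = CycEnvelope.inMu R.augY R.chi (a ^ n))
    (a : R.mu) :
    ((extEquiv (e.trans τ.symm) a : ((CycEnvelope.proj R.augY R.chi).comp
        (e.trans τ.symm).toMulEquiv.toMonoidHom).ker) : M.Pi) =
      ((extEquiv e (a ^ n) : ((CycEnvelope.proj R.augY R.chi).comp e.toMulEquiv.toMonoidHom).ker) :
        M.Pi) := by
  rw [coe_extEquiv, coe_extEquiv]
  change e.symm (τ.symm.symm (CycEnvelope.inMu R.augY R.chi a)) = _
  rw [ContinuousMulEquiv.symm_symm, hinMu]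

end ModelFrame

end Literature.IUT.HodgeArakelov
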